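import Literature.NumberTheory.Automorphic.ShimuraCurveRibetTakahashiDenominatorProofs
import Literature.NumberTheory.Automorphic.ShimuraCurveRibetTakahashiAssemblyProofs
import HarnessLib

/-!
# Pasten 2024, Thm. 6.1 (b) (denominator of `γ_{D,M,E}`): assembly of the printed proof over the
# tree's facts — Lemma 6.8 and the Shimura curves discharged, the open content isolated

Topic `NumberTheory/Automorphic`; a proofs-only companion (theorems only: no definition, no named
fact, nothing restated; D-0026) of `ShimuraCurveRibetTakahashi.lean`, for its named fact
`Literature.NumberTheory.Automorphic.PastenShimura2024_thm_6_1_b` (H. Pasten, *Shimura curves and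
the abc conjecture*, J. Number Theory 254 (2024) = arXiv:1705.09251, Thm. 6.1 (b) p. 20: "There is
an absolute integer constant `κ ≥ 1` supported on primes `≤ 163` which satisfies the following:
Suppose that either (b.1) `E` is semi-stable and `M` is not a prime number; or (b.2) `E` is a
Frey–Hellegouarch elliptic curve and `M` is divisible by at least two odd primes. Then the
denominator of `γ_{D,M,E}` divides `κ^{ω(D)}`"), the part-(b) twin of
`ShimuraCurveRibetTakahashiAssemblyProofs.lean` (numerator statement).

`ShimuraCurveRibetTakahashiDenominatorProofs.lean` performs the whole printed proof of part (b)
(§6.9 p. 25: the bounded two-prime step (EqSequentially) from Prop. 6.13 with Lemma 6.14 and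
Thm. 6.17, and Lemma 6.8; then the telescoping over `D = p₁r₁⋯pₙrₙ`, the class (b.1)/(b.2) passing
to the intermediate levels) and leaves
`PastenShimura2024_thm_6_1_b_of_prop_6_13_bounded_of_lemma_6_8 :
hX → hP → h0 → (κ₁, κ₂) → h613b → h68 → Thm. 6.1 (b)` with the inputs as hypotheses. Two of them
are available in the tree and are discharged here, exactly as the sibling does for the numerator:

* `hX` (Shimura curve data `X₀^d(prM)` at the intermediate levels) is the THEOREM
  `nonempty_shimuraCurveData_holds` (`ShimuraCurveDataExistence.lean`, Vignéras LNM 800);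
* `h68` (Lemma 6.8 p. 22 in the idiom `v_p(Δ_{W'}) · b = a · v_p(Δ_W)`, `1 ≤ a, b ≤ 163`, for
  `W ∼ W'` and `p ∥ N_W`) is the sibling's `lemma_6_8_factorization_form` applied to the NAMED FACT
  `Literature.NumberTheory.EllipticCurves.ModularForms.PastenShimura2024_lemma_6_8`
  (`PastenHeightBounds.lean`), itself reduced in the tree to Mazur–Kenku alone
  (`PastenShimura2024_lemma_6_8_of_mazurKenku'`, `PastenHeightBoundsLemma68LocalProofs.lean`).

What is proved (sorry-free):

* `PastenShimura2024_thm_6_1_b_of_prop_6_13_bounded_of_lemma_6_8_fact` — Thm. 6.1 (b) from the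
  named facts `nonempty_shimuraParametrizationData` (Jacquet–Langlands, Pasten §2 p. 12) and
  `PastenShimura2024_lemma_6_8`, and the two inputs that are not declarations of the tree: `h0`
  (the case `D = 1`, `J₀^1(N) = J₀(N)`, §2 p. 12: in the class, the class-minimal degree of Shimura
  data on a `ShimuraCurveData 1 N` divides `δ_{1,N}`; the fact gives it back,
  `deg_dvd_of_PastenShimura2024_thm_6_1_b`) and `h613b` (Prop. 6.13 p. 23 = Ribet–Takahashi 1997
  Thm. 2, with `i_p(d,prM) ∣ κ₁` from Lemma 6.14 p. 23 and `j_r(D,M) ∣ κ₂` from Thm. 6.17 p. 24 in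
  the class — Néron models and component groups of `J₀^D(M)`, Ribet's Eisenstein property,
  Lemmas 6.5–6.7 (Faltings, Chebotarev), Lemmas 6.9–6.12 (Darmon–Granville, Ribet's
  level-lowering, Wiles, Darmon–Merel): no vocabulary in the tree);
* `PastenShimura2024_thm_6_1_b_of_prop_6_13_bounded_of_mazurKenku` — the same with Lemma 6.8
  replaced by its only remaining input, the named fact
  `Literature.NumberTheory.EllipticCurves.mazurKenku_exists_cyclic_isogeny` (Mazur 1978 Thm. 1,
  Kenku 1982; Silverman AEC IX.6 Ex. 6.4);
* `deg_eq_modularDegree_of_PastenShimura2024_thm_6_1_of_thm_6_1_b` — **the two renderings of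
  `δ_{1,N}` agree at `D = 1`, granted both facts**: the numerator fact gives
  `δ_{1,N} ∣ deg P` (`dvd_deg_of_PastenShimura2024_thm_6_1`, sibling NumeratorProofs) and part (b)
  gives `deg P ∣ δ_{1,N}` in the class (`deg_dvd_of_PastenShimura2024_thm_6_1_b`), so
  `deg P = δ_{1,N}` for every class-minimal Shimura datum `P` on a `ShimuraCurveData 1 N` and
  every newform-minimal classical datum `D₁` — Pasten's `X₀^1(N) = X₀(N)` (§2 p. 12) as far as the
  two facts see it; i.e. the two `D = 1` bridges `h0` of the numerator and denominator assemblies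
  are jointly equivalent to this equality.

So `PastenShimura2024_thm_6_1_b_holds` is
`PastenShimura2024_thm_6_1_b_of_prop_6_13_bounded_of_mazurKenku mazurKenku_exists_cyclic_isogeny_holds
nonempty_shimuraParametrizationData_holds h0 hκ₁ hκ₂ hκ₁' hκ₂' h613b` once Mazur–Kenku and the
Jacquet–Langlands existence are theorems of the tree and `h0`, `h613b` (with their constants
`κ₁ = κ_∅` resp. `κ_{2}` of Lemma 6.14 and `κ₂ = κ` of Thm. 6.17) are available; nothing else of
the printed proof of part (b) is missing. The constant of the fact is then `κ₁² κ₂² (163!)²`.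

## References

* H. Pasten, *Shimura curves and the abc conjecture*, J. Number Theory 254 (2024) 214–335 =
  arXiv:1705.09251: §2 p. 12, Thm. 6.1 (b) p. 20, §6.4 and Lemma 6.8 p. 22, Prop. 6.13 and
  Lemma 6.14 p. 23, Thm. 6.17 p. 24, §6.9 p. 25 (held arXiv text, read). [PastenShimura2024]
* K. A. Ribet, S. Takahashi, *Parametrizations of elliptic curves by Shimura curves and by
  classical modular curves*, PNAS 94 (1997) 11110–11114, Thm. 2. [RibetTakahashi1997]
* B. Mazur, *Rational isogenies of prime degree*, Invent. Math. 44 (1978), Thm. 1 [Mazur1978];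
  M. A. Kenku, J. Number Theory 15 (1982) 199–202 [Kenku1982]; J. H. Silverman, *The Arithmetic
  of Elliptic Curves*, 2nd ed., IX.6 Ex. 6.4 [SilvermanAEC2009].
-/

noncomputable section

open scoped MatrixGroups ModularForm

namespace Literature.NumberTheory.Automorphic

open Literature.NumberTheory.EllipticCurves (mazurKenku_exists_cyclic_isogeny)
open Literature.NumberTheory.EllipticCurves.ModularForms (ModularParametrizationData IsNewformOf
  PastenShimura2024_lemma_6_8 PastenShimura2024_lemma_6_8_of_mazurKenku')

/-! ### Thm. 6.1 (b) over the tree's facts -/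

/-- **Pasten 2024, Thm. 6.1 (b) (denominator of `γ_{D,M,E}`) from Prop. 6.13 with Lemma 6.14 and
Thm. 6.17, with Lemma 6.8 and the Shimura curves taken from the tree.** The printed proof (§6.9
p. 25: "the result of item (b) is also obtained by a similar argument. Here, the cokernel factors
`j_r(dpr,m)²` are controlled by Theorem 6.17 instead of Lemma 6.18" —
`PastenShimura2024_thm_6_1_b_of_prop_6_13_bounded_of_lemma_6_8` of
`ShimuraCurveRibetTakahashiDenominatorProofs.lean`) with: the intermediate curves `X₀^d(prM)` from
the THEOREM `nonempty_shimuraCurveData_holds`; Lemma 6.8 from the named fact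
`PastenShimura2024_lemma_6_8` (`lemma_6_8_factorization_form`); the Jacquet–Langlands data at the
intermediate levels from the named fact `nonempty_shimuraParametrizationData` (§2 p. 12); and the
two inputs without a declaration in the tree kept as hypotheses — `h0`, the case `D = 1`
(`J₀^1(N) = J₀(N)`, §2 p. 12: in the class (b.1)/(b.2), the class-minimal degree of Shimura data
on a `ShimuraCurveData 1 N` divides the class-minimal classical degree `δ_{1,N}`; equivalent to the
fact at `D = 1`, `deg_dvd_of_PastenShimura2024_thm_6_1_b`), and `h613b`, Prop. 6.13 p. 23
(= Ribet–Takahashi 1997 Thm. 2) in the tree's minimal-degree idiom with `c_p(A) = v_p(Δ_A)` (§6.4)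
of the curves of the class-minimal data and the component-group indices `i = i_p(d,prM)`,
`j = j_r(D,M)` existential, carrying the bounds `i ∣ κ₁` (Lemma 6.14, `N` squarefree away from
`S = ∅` resp. `{2}` in the class) and `j ∣ κ₂` (Thm. 6.17, in the class); `κ₁, κ₂ ≥ 1` supported
on primes `≤ 163`. The constant of the fact is `κ₁² κ₂² (163!)²`.
[cite: PastenShimura2024, Thm. 6.1 (b) p. 20, proof §6.9 p. 25, Prop. 6.13 and Lemma 6.14 p. 23, Thm. 6.17 p. 24, Lemma 6.8 p. 22, §2 p. 12] -/
theorem PastenShimura2024_thm_6_1_b_of_prop_6_13_bounded_of_lemma_6_8_fact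
    (h68 : PastenShimura2024_lemma_6_8) (hP : nonempty_shimuraParametrizationData)
    (h0 : ∀ {N : ℕ} [NeZero N] (X : ShimuraCurveData 1 N) (W : WeierstrassCurve ℚ) [W.IsElliptic]
      [W.IsGloballyMinimal], W.conductorNorm ℤ = N →
      (W.IsSemistable ℤ ∧ ¬ N.Prime) ∨
        (IsFreyHellegouarch W ∧ 2 ≤ (N.primeFactors.erase 2).card) →
      ∀ (W₁ : WeierstrassCurve ℚ) [W₁.IsElliptic] (D₁ : ModularParametrizationData W₁ N),
        IsNewformOf W D₁.f →
        (∀ (W₂ : WeierstrassCurve ℚ) [W₂.IsElliptic] (D₂ : ModularParametrizationData W₂ N),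
            D₂.f = D₁.f → D₁.modularDegree ≤ D₂.modularDegree) →
      ∀ (W' : WeierstrassCurve ℚ) [W'.IsElliptic] (P : ShimuraParametrizationData X W'),
        P.IsMinimalFor W → P.deg ∣ D₁.modularDegree)
    {κ₁ κ₂ : ℕ} (hκ₁ : 1 ≤ κ₁) (hκ₂ : 1 ≤ κ₂) (hκ₁' : ∀ p ∈ κ₁.primeFactors, p ≤ 163)
    (hκ₂' : ∀ p ∈ κ₂.primeFactors, p ≤ 163)
    (h613b : ∀ {N D M d p r : ℕ}, p.Prime → r.Prime → p ≠ r → D = d * (p * r) →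
      IsAdmissibleFactorization N D M →
      ∀ (X₁ : ShimuraCurveData d (p * r * M)) (X₂ : ShimuraCurveData D M)
        (W : WeierstrassCurve ℚ) [W.IsElliptic] [W.IsGloballyMinimal], W.conductorNorm ℤ = N →
        (W.IsSemistable ℤ ∧ ¬ M.Prime) ∨
          (IsFreyHellegouarch W ∧ 2 ≤ (M.primeFactors.erase 2).card) →
      ∀ (W₁' : WeierstrassCurve ℚ) [W₁'.IsElliptic] (P₁ : ShimuraParametrizationData X₁ W₁'),
        P₁.IsMinimalFor W →
      ∀ (W₂' : WeierstrassCurve ℚ) [W₂'.IsElliptic] (P₂ : ShimuraParametrizationData X₂ W₂'),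
        P₂.IsMinimalFor W →
        ∃ i j : ℕ, 0 < i ∧ 0 < j ∧ i ∣ κ₁ ∧ j ∣ κ₂ ∧
          P₁.deg * (i ^ 2 * j ^ 2) = P₂.deg *
            ((W₁'.minimalDiscriminantNorm ℤ).factorization p *
              (W₂'.minimalDiscriminantNorm ℤ).factorization r)) :
    PastenShimura2024_thm_6_1_b :=
  PastenShimura2024_thm_6_1_b_of_prop_6_13_bounded_of_lemma_6_8 nonempty_shimuraCurveData_holds hP
    h0 hκ₁ hκ₂ hκ₁' hκ₂' h613b
    fun W W' _ _ hiso p hp hpN hp2 => lemma_6_8_factorization_form h68 W W' hiso p hp hpN hp2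

/-- **Pasten 2024, Thm. 6.1 (b) (denominator of `γ_{D,M,E}`) from Prop. 6.13 (with Lemma 6.14 and
Thm. 6.17) and Mazur–Kenku.** As `PastenShimura2024_thm_6_1_b_of_prop_6_13_bounded_of_lemma_6_8_fact`,
with Lemma 6.8 replaced by the only input of its printed proof that is not a theorem of the tree,
the named fact `mazurKenku_exists_cyclic_isogeny` (p. 22: "by results of Mazur and Kenku we know
that `n := deg(α) ≤ 163`"; the rest of that proof is the tree's
`PastenShimura2024_lemma_6_8_of_mazurKenku'`). Hence the discharge of the fact waits exactly for:
Mazur–Kenku, the Jacquet–Langlands existence `nonempty_shimuraParametrizationData`, the `D = 1`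
bridge `h0`, and Prop. 6.13 with the bounds of Lemma 6.14 and Thm. 6.17 (`h613b`).
[cite: PastenShimura2024, Thm. 6.1 (b) p. 20, proof §6.9 p. 25, Prop. 6.13 and Lemma 6.14 p. 23, Thm. 6.17 p. 24, Lemma 6.8 p. 22 (proof)] [cite: Mazur1978, Thm. 1] [cite: Kenku1982] -/
theorem PastenShimura2024_thm_6_1_b_of_prop_6_13_bounded_of_mazurKenku
    (hMK : mazurKenku_exists_cyclic_isogeny) (hP : nonempty_shimuraParametrizationData)
    (h0 : ∀ {N : ℕ} [NeZero N] (X : ShimuraCurveData 1 N) (W : WeierstrassCurve ℚ) [W.IsElliptic]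
      [W.IsGloballyMinimal], W.conductorNorm ℤ = N →
      (W.IsSemistable ℤ ∧ ¬ N.Prime) ∨
        (IsFreyHellegouarch W ∧ 2 ≤ (N.primeFactors.erase 2).card) →
      ∀ (W₁ : WeierstrassCurve ℚ) [W₁.IsElliptic] (D₁ : ModularParametrizationData W₁ N),
        IsNewformOf W D₁.f →
        (∀ (W₂ : WeierstrassCurve ℚ) [W₂.IsElliptic] (D₂ : ModularParametrizationData W₂ N),
            D₂.f = D₁.f → D₁.modularDegree ≤ D₂.modularDegree) →
      ∀ (W' : WeierstrassCurve ℚ) [W'.IsElliptic] (P : ShimuraParametrizationData X W'),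
        P.IsMinimalFor W → P.deg ∣ D₁.modularDegree)
    {κ₁ κ₂ : ℕ} (hκ₁ : 1 ≤ κ₁) (hκ₂ : 1 ≤ κ₂) (hκ₁' : ∀ p ∈ κ₁.primeFactors, p ≤ 163)
    (hκ₂' : ∀ p ∈ κ₂.primeFactors, p ≤ 163)
    (h613b : ∀ {N D M d p r : ℕ}, p.Prime → r.Prime → p ≠ r → D = d * (p * r) →
      IsAdmissibleFactorization N D M →
      ∀ (X₁ : ShimuraCurveData d (p * r * M)) (X₂ : ShimuraCurveData D M)
        (W : WeierstrassCurve ℚ) [W.IsElliptic] [W.IsGloballyMinimal], W.conductorNorm ℤ = N →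
        (W.IsSemistable ℤ ∧ ¬ M.Prime) ∨
          (IsFreyHellegouarch W ∧ 2 ≤ (M.primeFactors.erase 2).card) →
      ∀ (W₁' : WeierstrassCurve ℚ) [W₁'.IsElliptic] (P₁ : ShimuraParametrizationData X₁ W₁'),
        P₁.IsMinimalFor W →
      ∀ (W₂' : WeierstrassCurve ℚ) [W₂'.IsElliptic] (P₂ : ShimuraParametrizationData X₂ W₂'),
        P₂.IsMinimalFor W →
        ∃ i j : ℕ, 0 < i ∧ 0 < j ∧ i ∣ κ₁ ∧ j ∣ κ₂ ∧
          P₁.deg * (i ^ 2 * j ^ 2) = P₂.deg *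
            ((W₁'.minimalDiscriminantNorm ℤ).factorization p *
              (W₂'.minimalDiscriminantNorm ℤ).factorization r)) :
    PastenShimura2024_thm_6_1_b :=
  PastenShimura2024_thm_6_1_b_of_prop_6_13_bounded_of_lemma_6_8_fact
    (PastenShimura2024_lemma_6_8_of_mazurKenku' hMK) hP h0 hκ₁ hκ₂ hκ₁' hκ₂' h613b

/-! ### At `D = 1` the two renderings of `δ_{1,N}` agree, granted both facts -/

/-- **`deg P = δ_{1,N}` at `D = 1`, from the two facts.** Pasten §2 p. 12: "`X₀^1(N) = X₀(N)`",
so at the admissible factorisation `N = 1 · N` both `δ_{1,N}` (rendered through a newform-minimal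
classical datum `D₁ : ModularParametrizationData W₁ N`) and `δ_{1,N}` again (rendered through a
class-minimal Shimura datum `P` on an `X : ShimuraCurveData 1 N`) are the degree of the optimal
quotient `X₀(N) → A_{1,N}`. The tree sees this equality exactly through the two facts: the
numerator statement gives `δ_{1,N} · b = a · deg P` with `a ≤ 163⁰ = 1`, i.e. `δ_{1,N} ∣ deg P`
(`dvd_deg_of_PastenShimura2024_thm_6_1`), and part (b) gives, in the class (b.1)/(b.2),
`δ_{1,N} · b = a · deg P` with `b ∣ κ⁰ = 1`, i.e. `deg P ∣ δ_{1,N}`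
(`deg_dvd_of_PastenShimura2024_thm_6_1_b`); antisymmetry of divisibility. In particular the two
`D = 1` bridges `h0` of `PastenShimura2024_thm_6_1_of_prop_6_13_of_mazurKenku` and
`PastenShimura2024_thm_6_1_b_of_prop_6_13_bounded_of_mazurKenku` hold together as soon as this
equality does. [cite: PastenShimura2024, §2 p. 12 (X₀^1(N) = X₀(N)) with Thm. 6.1 and Thm. 6.1 (b) p. 20 (case D = 1)] -/
theorem deg_eq_modularDegree_of_PastenShimura2024_thm_6_1_of_thm_6_1_b
    (h : PastenShimura2024_thm_6_1) (hb : PastenShimura2024_thm_6_1_b) {N : ℕ} [NeZero N]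
    (X : ShimuraCurveData 1 N) (W : WeierstrassCurve ℚ) [W.IsElliptic] [W.IsGloballyMinimal]
    (hWN : W.conductorNorm ℤ = N)
    (hcl : (W.IsSemistable ℤ ∧ ¬ N.Prime) ∨
      (IsFreyHellegouarch W ∧ 2 ≤ (N.primeFactors.erase 2).card))
    (W₁ : WeierstrassCurve ℚ) [W₁.IsElliptic] (D₁ : ModularParametrizationData W₁ N)
    (hf : IsNewformOf W D₁.f)
    (hmin : ∀ (W₂ : WeierstrassCurve ℚ) [W₂.IsElliptic] (D₂ : ModularParametrizationData W₂ N),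
      D₂.f = D₁.f → D₁.modularDegree ≤ D₂.modularDegree)
    (W' : WeierstrassCurve ℚ) [W'.IsElliptic] (P : ShimuraParametrizationData X W')
    (hP : P.IsMinimalFor W) : P.deg = D₁.modularDegree :=
  Nat.dvd_antisymm (deg_dvd_of_PastenShimura2024_thm_6_1_b hb X W hWN hcl W₁ D₁ hf hmin W' P hP)
    (dvd_deg_of_PastenShimura2024_thm_6_1 h X W hWN W₁ D₁ hf hmin W' P hP)

end Literature.NumberTheory.Automorphic

end
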